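/-
Copyright (c) 2026. All rights reserved.
Released under Apache 2.0 license as described in the file LICENSE.
Authors: abc-iut cell, statement-typer seat abc-iut-L4-t3 (wave 1; gen 8), over abc-iut-f-101's genuine `η⊢`-components
and coherence datum, abc-iut-w4-d095's / abc-iut-w5-d053's genuine `ι^{An⊢⊞}`-data, abc-iut-L4-t9's MLF model.
-/
import Literature.AnabelianGeometry.AbsoluteAnabelian.LogFrobeniusIotaEtaSquare
import Literature.AnabelianGeometry.AbsoluteAnabelian.LogFrobeniusMonoTelecoreGenuineOpen
import HarnessLib

/-!
# [AbsTopIII] Corollary 5.10 (iv)(c): the `η⊢`-naturality square HOLDS at the genuine open-augmentation setting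

S. Mochizuki, *Topics in absolute anabelian geometry III: global reconstruction algorithms*,
J. Math. Sci. Univ. Tokyo 22 (2015) 939–1156 [MochizukiAbsTopIII2015]; locators `p.N` = pages of the author's
manuscript (`paper:url-5493eb38cbb7`), read on the page: Cor 5.10 (iv)(c) p. 148 l. 39–51 (the homotopies `η⊢_{v,ν}`,
`(η⊢_{v,ν})⁻¹`, the mono-analyticization homotopies and the `ι^{An⊢⊞}_{v,ε}`-homotopies generate ONE contact structure
`ℋ_{An⊢}`, compatible with the `ι⊞_{v,ε}`-homotopies of `S_log⊞`, `ε ∈ Γ⃗×_v`); Def 5.4 (iii) p. 126 (the four arrows of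
`Γ⃗×_non`: `𝒪^× ↪ k̄^×`, the shell-arrow `𝒪^× → k~`, `k̄^× → (k̄^×)^pf`, `k~ ↪ (k̄^×)^pf`); Def 3.1 (i) p. 66 (`log_k̄`,
`k~ = (𝒪^×_k̄)^pf`); Prop 5.8 (ii) p. 139, (vii) p. 142.

PROOF-ONLY companion (theorems only, nothing restated) of this lineage's `LogFrobeniusIotaEtaSquare.lean`
(`MonoTelecoreCoherence.EtaNatural`: the edge-indexed coherence datum of print's single family, typed; satisfiable at
the degenerate tagged setting; independent of the interface, `…Independence.lean`).  Here: **the square at a GENUINE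
carrier.**  At abc-iut-f-101's open-augmentation setting `genuineOpen p Vmod` (abc-iut-w5-d053's sub-model of
abc-iut-L4-t9's MLF model with OPEN `ε_k`; abc-iut-w4-d095's genuine perfected mono-analytic containers) with
* `K := monoTelecoreCoherence_open p Vmod` — abc-iut-f-101's GENUINE `η⊢_{v,ν}` (identity of `𝒪^×_{ℚ̄_p}` / `ℚ̄_p^×`, the
  `p`-adic LOGARITHM `log_k̄ : 𝒪^× ⧸ μ ⥲ k̄` at `k~`, identity of `ℚ̄_p^× ⧸ μ` at `(k̄^×)^pf`), and
* `I := nonarchGenuineMonoAnPfOpen_iotaAnMono p Vmod _` — the genuine `ι^{An⊢⊞}_{v,ε}` (inclusion, the two torsion-quotient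
  maps, the inclusion of quotients) over the SAME "`ψ` over `ℰ⊢`" datum,
the `η⊢`-naturality square `K.EtaNatural I` HOLDS (`etaNatural_genuineOpen`).  Edge by edge (the content, `𝒞_TS`-level,
`TFModel.eta…_square`): along `𝒪^× ↪ k̄^×` two inclusions agree; along the SHELL-ARROW `𝒪^× → k~` the holomorphic arrow is
the `p`-adic logarithm (abc-iut-L4-t9's `iotaShell`, "log-coordinates") and the mono-analytic arrow is the quotient
`𝒪^× → 𝒪^× ⧸ μ` followed by `η⊢_{k~} = log_k̄` — they agree because `log_k̄` FACTORS through the torsion quotient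
(Def 3.1 (i)); along `k̄^× → (k̄^×)^pf` two quotient maps agree; along `k~ ↪ (k̄^×)^pf` the holomorphic arrow
`y ↦ [log_k̄⁻¹ y]` (abc-iut-L4-t9's `addToPf`) after `log_k̄` is the inclusion of quotients — `log_k̄⁻¹ ∘ log_k̄ = id` on
`𝒪^× ⧸ μ`.  On Galois groups every leg is `ε_k(g) ↦ [g]`.  So the genuine model passes the compatibility test print's
single contact family imposes on (`η⊢`, `ι⊞`, `ι^{An⊢⊞}`): the three add-ons `MonoAnalyticizationHomotopies`,
`MonoTelecoreCoherence`, `IotaAnMono` AND `EtaNatural` are SIMULTANEOUSLY inhabited at a genuine carrier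
(`exists_genuine_etaNatural`).

HONEST FRAMING / LIMITS: MODEL-LEVEL exactly as the parents (one nonarchimedean place type, all places nonarchimedean,
archimedean rows placeholders; `ℰ• := 𝒳`, `An• := 𝒳`; discrete arithmetic data; torsion-quotient perfections); classical
local class field theory and the `p`-adic logarithm as proved in the tree; refereed pre-IUT material; nothing here bears
on [IUTchIII] Cor. 3.12; OUR kernel check, no side taken; instantiated ≠ endorsed; typed ≠ proved elsewhere.
-/

set_option autoImplicit false

noncomputable section

namespace Literature.AnabelianGeometry.AbsoluteAnabelian

open CategoryTheory Topology
open Literature.NumberTheory.Transcendental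
open scoped nonZeroDivisors

namespace AbsTopIII

namespace TFModel

variable {p : ℕ} [Fact p.Prime] (A : TFModel p) (hA : IsOpenMap A.D.aug)

/-! ## Part 1. The Galois legs: `ε_k(g) ↦ [g]` at every vertex of `Γ⃗×_non` -/

/-- `η⊢` at `k̄^×` on Galois groups: `ε_k(g) ↦ [g]`. [cite: MochizukiAbsTopIII2015, Cor 5.10 (iv)(c) p. 148] -/
theorem etaTimesIso_hom_homPi_aug (g : A.pair.Pi) :
    (A.etaTimesIso hA).hom.homPi (show (MLFClosure.timesObj (closure A)).pair.Pi from A.D.aug g) =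
      (show (TSObj.monoAn.obj A.lamTimesObj).pair.Pi from QuotientGroup.mk g) := by
  haveI : @Subgroup.Normal A.pair.Pi _ A.lamTimesObj.actionKer := TSObj.actionKer_normal A.lamTimesObj
  exact A.augQuotientIso_symm_aug _ _ hA g

/-- `η⊢` at `k~` on Galois groups: `ε_k(g) ↦ [g]`. [cite: MochizukiAbsTopIII2015, Cor 5.10 (iv)(c) p. 148] -/
theorem etaShellIso_hom_homPi_aug (g : A.pair.Pi) :
    (A.etaShellIso hA).hom.homPi (show (MLFClosure.unitsPfObj (closure A)).pair.Pi from A.D.aug g) =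
      (show (TSObj.monoAn.obj A.lamAddObj).pair.Pi from QuotientGroup.mk g) := by
  haveI : @Subgroup.Normal A.pair.Pi _ A.lamAddObj.actionKer := TSObj.actionKer_normal A.lamAddObj
  exact A.augQuotientIso_symm_aug _ _ hA g

/-- `η⊢` at `(k̄^×)^pf` on Galois groups: `ε_k(g) ↦ [g]`. [cite: MochizukiAbsTopIII2015, Cor 5.10 (iv)(c) p. 148] -/
theorem etaPerfIso_hom_homPi_aug (g : A.pair.Pi) :
    (A.etaPerfIso hA).hom.homPi (show (MLFClosure.timesPfObj (closure A)).pair.Pi from A.D.aug g) =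
      (show (TSObj.monoAn.obj A.lamTimesPfObj).pair.Pi from QuotientGroup.mk g) := by
  haveI : @Subgroup.Normal A.pair.Pi _ A.lamTimesPfObj.actionKer := TSObj.actionKer_normal A.lamTimesPfObj
  exact A.augQuotientIso_symm_aug _ _ hA g

/-! ## Part 2. The four edge squares of `Γ⃗×_non` in `𝒞_TS` -/

/-- **Edge `𝒪^× ↪ k̄^×`**: `η⊢_{𝒪^×} ≫ (𝒩⊞→𝒩⊢⊞)(ι⊞) = ι^{An⊢⊞} ≫ η⊢_{k̄^×}` — two inclusions of `𝒪^×_{ℚ̄_p}` into `ℚ̄_p^×`.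
[cite: MochizukiAbsTopIII2015, Cor 5.10 (iv)(c) p. 148] -/
theorem etaUnits_etaTimes_square :
    (A.etaUnitsIso hA).hom ≫ TSObj.monoAn.map ((iotaUnitsToTimes p).app A) =
      MLFClosure.kbarUnitsToTimes.app (closureObj A) ≫ (A.etaTimesIso hA).hom := by
  refine TSObj.Hom.ext (MonoidHom.ext fun σ => ?_) (funext fun x => TimesCarrier.ext rfl)
  obtain ⟨g, rfl⟩ := A.D.aug_surjective σ
  change (TSObj.monoAn.map ((iotaUnitsToTimes p).app A) : TSObj.Hom _ _).homPi
      ((A.etaUnitsIso hA).hom.homPi (show (MLFClosure.unitsObj (closure A)).pair.Pi from A.D.aug g)) =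
    (A.etaTimesIso hA).hom.homPi (show (MLFClosure.timesObj (closure A)).pair.Pi from A.D.aug g)
  rw [etaUnitsIso_hom_homPi_aug, etaTimesIso_hom_homPi_aug]
  rfl

/-- **The SHELL edge `𝒪^× → k~`**: `η⊢_{𝒪^×} ≫ (𝒩⊞→𝒩⊢⊞)(log_k̄) = (𝒪^× → 𝒪^× ⧸ μ) ≫ η⊢_{k~}` — the holomorphic shell-arrow is
the `p`-adic LOGARITHM and `η⊢_{k~}` is `log_k̄` on the torsion quotient: `log_k̄` factors through `𝒪^× → 𝒪^× ⧸ μ`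
(Def 3.1 (i)). [cite: MochizukiAbsTopIII2015, Cor 5.10 (iv)(c) p. 148] -/
theorem etaUnits_etaShell_square :
    (A.etaUnitsIso hA).hom ≫ TSObj.monoAn.map ((iotaShell p).app A) =
      MLFClosure.kbarUnitsToUnitsPf.app (closureObj A) ≫ (A.etaShellIso hA).hom := by
  refine TSObj.Hom.ext (MonoidHom.ext fun σ => ?_) (funext fun x => AddCarrier.ext rfl)
  obtain ⟨g, rfl⟩ := A.D.aug_surjective σ
  change (TSObj.monoAn.map ((iotaShell p).app A) : TSObj.Hom _ _).homPi
      ((A.etaUnitsIso hA).hom.homPi (show (MLFClosure.unitsObj (closure A)).pair.Pi from A.D.aug g)) =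
    (A.etaShellIso hA).hom.homPi (show (MLFClosure.unitsPfObj (closure A)).pair.Pi from A.D.aug g)
  rw [etaUnitsIso_hom_homPi_aug, etaShellIso_hom_homPi_aug]
  rfl

/-- **Edge `k̄^× → (k̄^×)^pf`**: `η⊢_{k̄^×} ≫ (𝒩⊞→𝒩⊢⊞)(ι_×) = (k̄^× → k̄^× ⧸ μ) ≫ η⊢_{(k̄^×)^pf}` — two quotient maps.
[cite: MochizukiAbsTopIII2015, Cor 5.10 (iv)(c) p. 148] -/
theorem etaTimes_etaPerf_square :
    (A.etaTimesIso hA).hom ≫ TSObj.monoAn.map ((iotaTimes p).app A) =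
      MLFClosure.kbarTimesToTimesPf.app (closureObj A) ≫ (A.etaPerfIso hA).hom := by
  refine TSObj.Hom.ext (MonoidHom.ext fun σ => ?_) (funext fun x => rfl)
  obtain ⟨g, rfl⟩ := A.D.aug_surjective σ
  change (TSObj.monoAn.map ((iotaTimes p).app A) : TSObj.Hom _ _).homPi
      ((A.etaTimesIso hA).hom.homPi (show (MLFClosure.timesObj (closure A)).pair.Pi from A.D.aug g)) =
    (A.etaPerfIso hA).hom.homPi (show (MLFClosure.timesPfObj (closure A)).pair.Pi from A.D.aug g)
  rw [etaTimesIso_hom_homPi_aug, etaPerfIso_hom_homPi_aug]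
  rfl

/-- **Edge `k~ ↪ (k̄^×)^pf`**: `η⊢_{k~} ≫ (𝒩⊞→𝒩⊢⊞)(y ↦ [log_k̄⁻¹ y]) = (𝒪^× ⧸ μ ↪ k̄^× ⧸ μ) ≫ η⊢_{(k̄^×)^pf}` — after
`η⊢_{k~} = log_k̄`, abc-iut-L4-t9's `addToPf = [log_k̄⁻¹(·)]` is the inclusion of quotients: `log_k̄⁻¹ ∘ log_k̄ = id` on
`𝒪^× ⧸ μ`. [cite: MochizukiAbsTopIII2015, Cor 5.10 (iv)(c) p. 148] -/
theorem etaShell_etaPerf_square :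
    (A.etaShellIso hA).hom ≫ TSObj.monoAn.map ((iotaAddToPf p).app A) =
      MLFClosure.kbarUnitsPfToTimesPf.app (closureObj A) ≫ (A.etaPerfIso hA).hom := by
  refine TSObj.Hom.ext (MonoidHom.ext fun σ => ?_) (funext fun x => ?_)
  · obtain ⟨g, rfl⟩ := A.D.aug_surjective σ
    change (TSObj.monoAn.map ((iotaAddToPf p).app A) : TSObj.Hom _ _).homPi
        ((A.etaShellIso hA).hom.homPi (show (MLFClosure.unitsPfObj (closure A)).pair.Pi from A.D.aug g)) =
      (A.etaPerfIso hA).hom.homPi (show (MLFClosure.timesPfObj (closure A)).pair.Pi from A.D.aug g)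
    rw [etaShellIso_hom_homPi_aug, etaPerfIso_hom_homPi_aug]
    rfl
  · induction x using QuotientGroup.induction_on with
    | H u =>
      -- the underlying unit of `u ∈ 𝒪^×_k̄` (units over `k`) as a unit over `ℚ_p` (same subset of `ℚ̄_p`)
      have hu₀ : (u : ((closure A).K)ˣ).1 ∈ unitSubmonoid ℚ_[p] (PadicAlgCl p) :=
        (SetLike.ext_iff.mp (PadicAlgCl.unitSubmonoid_subfield_eq A.k) _).mp u.2
      have key : (padicLog p).logEquiv.symm
          (Multiplicative.ofAdd (padicLogAlgCl p (u : ((closure A).K)ˣ).1)) =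
            QuotientGroup.mk (⟨(u : ((closure A).K)ˣ), hu₀⟩ : ↥(unitGroup ℚ_[p] (PadicAlgCl p))) := by
        rw [MulEquiv.symm_apply_eq]
        rfl
      change unitsPfIncl ((padicLog p).logEquiv.symm
          (Multiplicative.ofAdd (padicLogAlgCl p (u : ((closure A).K)ˣ).1))) =
        timesToPf (TimesCarrier.ofUnits (u : ((closure A).K)ˣ))
      rw [key]
      rfl

end TFModel

end AbsTopIII

namespace LogFrobeniusSetting

open AbsTopIII

variable (p : ℕ) [Fact p.Prime]

/-! ## Part 3. The edge squares dispatched on the edges of `Γ⃗×_non` -/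

/-- **The four edge squares at once**: for every edge `ε : ν₁ → ν₂` of `Γ⃗×_non` and every open-augmentation object `A`,
`η⊢_{ν₁}(A) ≫ (𝒩⊞→𝒩⊢⊞)(ι⊞_ε(A)) = ι^{An⊢⊞}_ε(G_{k_A}) ≫ η⊢_{ν₂}(A)` in `𝒞_TS` (abc-iut-f-101's `etaComp`, abc-iut-L4-t9's
`nonarchLocIota`, abc-iut-w4-d095's `monoContainerMapPf`); the two non-core arrows are excluded by `hε`.
[cite: MochizukiAbsTopIII2015, Cor 5.10 (iv)(c) p. 148] -/
theorem etaComp_square : ∀ {ν₁ ν₂ : LogVertex false} (ε : LogEdgeTS false ν₁ ν₂) (hε : ε.InCore)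
    (A : TFModelOpen p),
    (etaComp p ν₁ hε.isCross_src A).hom ≫ TSObj.monoAn.map ((nonarchLocIota p ε).app A.obj) =
      (MLFClosure.monoContainerMapPf false ε hε).app (TFModel.closureObj A.obj) ≫
        (etaComp p ν₂ hε.isCross_tgt A).hom
  | _, _, NonarchEdge.unitsToMult, _, A => A.obj.etaUnits_etaTimes_square A.property
  | _, _, NonarchEdge.shell, _, A => A.obj.etaUnits_etaShell_square A.property
  | _, _, NonarchEdge.multToPerf, _, A => A.obj.etaTimes_etaPerf_square A.property
  | _, _, NonarchEdge.shellCodToPerf, _, A => A.obj.etaShell_etaPerf_square A.property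
  | _, _, NonarchEdge.multToSpaceLink, h, _ => (NonarchEdge.not_inCore.1 h).elim
  | _, _, NonarchEdge.postLogId, h, _ => (NonarchEdge.not_inCore.2 h).elim

/-! ## Part 4. The square at the genuine open-augmentation setting -/

variable (Vmod : Type 1)

/-- At the genuine open-augmentation setting the untwisted `ι⊞_{v,ε}` along an edge of `Γ⃗×_v` is abc-iut-w5-d053's
`(𝟙, ι_ε ∘ ι)` (the cast `Λ_{ν₁} ∘ λ⊞ = λ⊞` is the model's own). [cite: MochizukiAbsTopIII2015, Def 5.4 (vii) p. 128] -/
theorem genuineOpen_iotaCore (v : Vmod) {ν₁ ν₂ : LogVertex false} (ε : LogEdgeTS false ν₁ ν₂) (hε : ε.InCore) :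
    (genuineOpen p Vmod).iotaCore v ε hε = nonarchIotaCoreSub p (TFModel.IsOpenAug (p := p)) false ε :=
  (genuineOpen p Vmod).iotaPre_eq_of_iota_eq v hε.toLogEdge hε.isCross_src.1 _ rfl

/-- ★ **[AbsTopIII] Cor 5.10 (iv)(c): the `η⊢`-naturality square HOLDS at the GENUINE open-augmentation setting** — for
abc-iut-f-101's coherence datum `K = monoTelecoreCoherence_open p Vmod` (genuine `η⊢`: identities, `log_k̄`, identity)
and abc-iut-w5-d053's / abc-iut-w4-d095's genuine `ι^{An⊢⊞}`-data over the same "`ψ` over `ℰ⊢`" datum, along every edge of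
every `Γ⃗×_v` and at every object of `𝒳^{open}`: on the base both sides are the identity of `G_{k_A}`, on `𝒞_TS` it is
`etaComp_square`. [cite: MochizukiAbsTopIII2015, Cor 5.10 (iv)(c) p. 148] -/
theorem etaNatural_genuineOpen :
    (monoTelecoreCoherence_open p Vmod).EtaNatural
      (nonarchGenuineMonoAnPfOpen_iotaAnMono p Vmod (fun _ => false)) := by
  intro v ν₁ ν₂ ε hε y
  -- the transport of `ι⊞_ε(A)` to `An⊢` is the identity: its base component is `𝟙_A`, and `conj(σ_𝟙) = 𝟙`
  have hG : ((genuineOpen p Vmod).forget v ⋙ (genuineOpen p Vmod).toE v ⋙ (genuineOpen p Vmod).monoAn ⋙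
      (genuineOpen p Vmod).κAnMono.functor).map (((genuineOpen p Vmod).iotaCore v ε hε).app y) = 𝟙 _ := by
    rw [genuineOpen_iotaCore]
    apply InducedCategory.hom_ext
    change MLFClosure.anMonoEquiv.functor.map ((TFModel.toMonoBase p).map (𝟙 y.down.obj)) = 𝟙 _
    rw [CategoryTheory.Functor.map_id, CategoryTheory.Functor.map_id]
  unfold IotaAnMono.gammaOneApp gammaZeroApp
  rw [hG]
  -- (`erw`: the source objects `An⊢`-transport of `λ⊞_{ν₁}(y)` / `λ⊞_{ν₂}(y)` agree only up to unfolding)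
  erw [CategoryTheory.Functor.map_id, Category.id_comp]
  rw [genuineOpen_iotaCore]
  apply InducedCategory.hom_ext
  apply Prod.hom_ext
  · -- base components: identities of `G_{k_A}` (`conj(σ_{𝟙}) = 𝟙`)
    change 𝟙 _ ≫ (toMonoBaseSub p (TFModel.IsOpenAug (p := p))).map (𝟙 y.down) = 𝟙 _ ≫ 𝟙 _
    rw [CategoryTheory.Functor.map_id]
  · -- `𝒞_TS`-components: the edge square
    change (etaComp p ν₁ _ y.down).hom ≫ TSObj.monoAn.map ((nonarchLocIota p ε).app y.down.obj) =
      (MLFClosure.monoContainerMapPf false ε hε).app (TFModel.closureObj y.down.obj) ≫ (etaComp p ν₂ _ y.down).hom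
    exact etaComp_square p ε hε y.down

/-- Bookkeeping form: at a §5 setting with GENUINE nonarchimedean and mono-analytic rows on `𝒳^{open}`, the three add-ons
`MonoAnalyticizationHomotopies`, `MonoTelecoreCoherence`, `IotaAnMono` are inhabited by genuine data AND the `η⊢`-naturality
square holds — and (for `V(F_mod) ≠ ∅`) so does the pinned Cor 5.10 (iv)(b)(c) (abc-iut-f-101).  The compatibility
that print's single family `ℋ_{An⊢} ∪ S_log⊞` imposes on (`η⊢`, `ι⊞`, `ι^{An⊢⊞}`) is met by the genuine model.
[cite: MochizukiAbsTopIII2015, Cor 5.10 (iv)(c) p. 148] -/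
theorem exists_genuine_etaNatural [Nonempty Vmod] :
    ∃ (L : LogFrobeniusSetting Vmod (fun _ => false)) (M : L.MonoAnalyticizationHomotopies)
      (K : L.MonoTelecoreCoherence M) (I : K.IotaData),
      L.X = Up (TFModelOpen p) ∧ K.EtaNatural I ∧ L.Cor510MonoTelecorePinned :=
  ⟨genuineOpen p Vmod, monoAnalyticizationHomotopies_open p Vmod, monoTelecoreCoherence_open p Vmod,
    nonarchGenuineMonoAnPfOpen_iotaAnMono p Vmod (fun _ => false), rfl, etaNatural_genuineOpen p Vmod,
    cor510MonoTelecorePinned_genuineOpen p Vmod⟩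

end LogFrobeniusSetting

end Literature.AnabelianGeometry.AbsoluteAnabelian

end
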